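import Summits.HodgeConjecture.HodgeConjecture.Theorems.F0P6aLineSpecialisationLaws
import HarnessLib

/-!
# `F0P6aLineSpecialisation` — ★ RE-HOME of `Lines/F0_P6a_LineSpecialisation.lean` (tree ED. 3 sha16 d6354130763e131e), PART 6 of 6 — tree lines :1631–:1864 (LAST part: the module the `Lines/` shim and consumers import; it transitively carries parts 1–5).

See PART 1 `Theorems/F0P6aLineSpecialisationLetters.lean` for the full ★ re-home header and the original module docstring (verbatim there).  Same namespace (every fully-qualified name unchanged);
the scopes open at the cut (`noncomputable section` ∕ `namespace` ∕ `section`s) are re-opened below with their `variable` ∕ `open` ∕ `set_option` ∕ `omit` ∕ `include` ∕ `universe` lines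
replayed verbatim from the tree, in order; the code after the replay block is the tree bytes :1631–:1864, untouched.  HC_CM is proved only modulo the 7 printed citations (2 remaining: hLiu418 = stmt-HodgeConjecture-24832, h413 = stmt-HodgeConjecture-24833) until rung 0 closes; a re-home is count-neutral.
-/

-- ── replay of the scopes open at tree line :1631 (verbatim) ──
set_option autoImplicit false
set_option linter.dupNamespace false
noncomputable section
namespace Summit.HodgeConjecture.HodgeConjecture.Cruxes.HLiu418.F0P6aLineSpecialisation
open CategoryTheory CategoryTheory.Limits NumberField IsDedekindDomain MulAction AlgebraicGeometry
open scoped Matrix Polynomial Pointwise MonoidalCategory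
open Literature.NumberTheory.GaloisRepresentations
open Literature.NumberTheory.Automorphic Literature.NumberTheory.Automorphic.UnitaryGroup
open Literature.AlgebraicGeometry.ShimuraVarieties.UnitaryCanonicalModel
open Literature.NumberTheory.Automorphic.Liu2021.AppendixC
open Literature.AlgebraicGeometry.Motives (AlgPoints IntegralModel SchemeOver thickening thickeningGalAction thickeningLift specOver extendPoint
  specValuationSubring specFractionFieldι specRingHomι)
open Literature.NumberTheory.DiophantineGeometry (geomResidueField specialFibreFunctor specResidueField geomClosedPointIsoSpecResidueField
  geomResidueFieldEquiv toClosureValuationSubring)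
open Literature.AlgebraicGeometry.RelativeSpec (ActionOver)
open Literature.NumberTheory.EllipticCurves (genericFibre specGenericPoint)
open Literature.AlgebraicGeometry.AbelianSchemes Literature.AlgebraicGeometry.AbelianSchemes.AbelianSchemeOver
open Literature.AlgebraicGeometry.GroupSchemes.AffineGroupScheme (Alg)
open Summit.HodgeConjecture.HodgeConjecture.Cruxes.HLiu418.F0P6aModuliDatumDefs
open Summit.HodgeConjecture.HodgeConjecture.Cruxes.HLiu418.F0P6aRGDAssembly
open Summit.HodgeConjecture.HodgeConjecture.Cruxes.HLiu418.F0P6aDatumOfInputs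
section Laws
set_option synthInstance.maxHeartbeats 100000
open Literature.AlgebraicGeometry.GroupSchemes (GroupSchemeKernel.ker GroupSchemeKernel.kerι natCard_sections_eq_natCard_algHom)
open Literature.AlgebraicGeometry.GroupSchemes.AffineGroupScheme (ptEquiv spI)
open Literature.AlgebraicGeometry.GroupSchemes.AdmIdealTransport
open Literature.AlgebraicGeometry.Motives (relFrobeniusOver frobeniusTwistOver)
open Summit.HodgeConjecture.HodgeConjecture.Cruxes.HLiu418.F0P6cDictConstructors (kerFI AdmSub IdealIsEtale IsAdm isAdm_kerFI
  eq_kerFI_or_idealIsEtale_of_isAdm)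
variable {F : Type} [Field F] [NumberField F] [IsCMField F] {ι₁ : F →+* ℂ}
    {Jstar : Matrix (Fin 2) (Fin 2) F}
    {K₀ : C5.OpenCompactSubgroup ↥(finAdelic ↥(maximalRealSubfield F) F (IsCMField.complexConj F) 2 Jstar)}
    {S : RecordSystemGS F Jstar ι₁ K₀} {hU7ₛ : S.HeckeTranslateDefinedOver}
    {hJ : (Jstar.map (IsCMField.complexConj F))ᵀ = Jstar} {hJu : IsUnit Jstar}
    {Fi : Type} [Field Fi] [Algebra F Fi] {Kc : C5.SmallLevel K₀} {G : Type} [Group G]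
    {𝓜 : IntegralModel (𝓞 F) F ((thickening F Fi).obj (S.M.obj Kc))}
    {w : HeightOneSpectrum (𝓞 F)} {hw : (IsCMField.complexConj F) • w ≠ w} {h𝓨 : (𝓜.localise w).IsSmoothProper 1}
    {θ : ActionOver (𝓜.localise w).total.hom ((Fi ≃ₐ[F] Fi) × G)}
    {e : Fi →ₐ[F] AlgebraicClosure (w.adicCompletion F)}
variable (I : RGDInputsAt F ι₁ Jstar K₀ S hU7ₛ hJ hJu Fi Kc G 𝓜 w hw h𝓨 θ e) [ExpChar (geomResidueField w) I.pChar] (𝔡 : ∀ xbar, DockAt I xbar)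
-- ── tree bytes :1631–:1864 ──

set_option maxHeartbeats 400000 in
open scoped MonObj CategoryTheory.Obj in
/-- **★ (E-b4′) ON THE LAYER OF THE LIFT**: if the dock at `red₀ y` has an étale admissible member, there is EXACTLY ONE admissible `L₀ ⊂ Γ(layerΩ I y)` with
`spI L₀ = kerFI (layerκ I y)` — ★ `CanonicalLine.existsUnique_admK_spI_eq_kerFI` with: `R = 𝒪_Ω̄` henselian (★ `ValuationSubring.henselianLocalRing_of_isAlgClosed`),
`toGeomκ` surjective with kernel `𝔪`, `βR` by homomorphisms, the unit component of `layerR I y` (★ `UnitComponentClopen.exists_unitComponent`), `hrkG`∕`hrkF`∕`hord` =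
`finrank_alg_layerκ_eq` ∕ `finrank_quotient_kerFI_layerκ_eq` ∕ `exists_admissible_etale_layerκ`.
[cite: SerreTate1968, §1 Lemma 1] [cite: Katz1973, §3.1] [cite: Liu2021, p. 136] -/
theorem exists_admK_spI_eq_kerFI (y : AlgPoints (S.M.obj Kc) (AlgebraicClosure (w.adicCompletion F))) (h : ∃ H : SubOf I 𝔡 (red₀Of S Kc 𝓜 w h𝓨 e y), IsEtaleOf I 𝔡 H) :
    letI := (toGeomκ w).toAlgebra
    haveI := isMonHom_transR I y
    haveI := isAffine_layerR_left I y
    haveI := isAffine_layerκ_left I y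
    haveI := isAffine_layerΩ_left I y
    ∃ L₀ : Ideal (Alg (layerΩ I y)), AdmKOf I y L₀ ∧
      spI (AlgebraicClosure (w.adicCompletion F)) (geomResidueField w) (layerR I y) L₀ = kerFI I.pChar I.fDeg (layerκ I y) ∧
      ∀ L : Ideal (Alg (layerΩ I y)), AdmKOf I y L → spI (AlgebraicClosure (w.adicCompletion F)) (geomResidueField w) (layerR I y) L = kerFI I.pChar I.fDeg (layerκ I y) → L = L₀ := by
  letI := (toGeomκ w).toAlgebra
  haveI := isMonHom_transR I y
  haveI := isAffine_layerR_left I y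
  haveI := isAffine_layerκ_left I y
  haveI := isAffine_layerΩ_left I y
  haveI : HenselianLocalRing ↥(closureValuationSubring (w.adicCompletion F)) := ValuationSubring.henselianLocalRing_of_isAlgClosed _
  haveI : Fact I.pChar.Prime := ⟨I.hpChar.1⟩
  haveI := I.charP₀
  haveI := isFinite_layerR_hom I y
  haveI := flat_layerR_hom I y
  obtain ⟨𝒰, _i𝒰, j𝒰, hjm, hjo, hjc, hconn⟩ :=
    Literature.AlgebraicGeometry.GroupSchemes.UnitComponentClopen.exists_unitComponent ↥(closureValuationSubring (w.adicCompletion F)) (layerR I y) (isFinite_layerR_hom I y)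
  haveI := hjc
  haveI : IsAffine 𝒰.left := isAffine_of_isAffineHom j𝒰.left
  haveI : IsFinite 𝒰.hom := by
    rw [← Over.w j𝒰]
    infer_instance
  haveI : IsAffine ((Over.pullback (sκ w)).obj 𝒰).left := by
    haveI : IsFinite ((Over.pullback (sκ w)).obj 𝒰).hom := MorphismProperty.pullback_snd _ _ inferInstance
    exact isAffine_of_isAffineHom ((Over.pullback (sκ w)).obj 𝒰).hom
  have hκ : Function.Surjective (algebraMap ↥(closureValuationSubring (w.adicCompletion F)) (geomResidueField w)) := by
    rw [algebraMap_eq_toGeomκ]; exact toGeomκ_surjective w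
  have hker : RingHom.ker (algebraMap ↥(closureValuationSubring (w.adicCompletion F)) (geomResidueField w)) = IsLocalRing.maximalIdeal ↥(closureValuationSubring (w.adicCompletion F)) := by
    rw [algebraMap_eq_toGeomκ]; exact ker_toGeomκ w
  obtain ⟨L₀, hA, hsp, hU⟩ := Literature.AlgebraicGeometry.GroupSchemes.CanonicalLine.existsUnique_admK_spI_eq_kerFI (AlgebraicClosure (w.adicCompletion F)) (geomResidueField w)
    (layerR I y) (βR I y) 𝒰 j𝒰 hκ hker (isMonHom_βR I y) ⟨hjm, hjo, hjc, hconn⟩ I.pChar I.fDeg (finrank_alg_layerκ_eq I 𝔡 y)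
    (finrank_quotient_kerFI_layerκ_eq I 𝔡 y) (exists_admissible_etale_layerκ I 𝔡 y h)
  exact ⟨L₀, hA, hsp, hU⟩

open scoped MonObj CategoryTheory.Obj in
/-- **AN ORDINARY DOCK HAS AN ÉTALE ADMISSIBLE MEMBER**: if `#G₀(κ̄) = q` the ideal of ALL `κ̄`-points is admissible and étale (★ (UP-ADM) §1 `isHopfIdeal_ker_pi_subgroup`,
`finrank_quotient_ker_pi_subgroup`, `map_appTop_ker_pi_subgroup_le_iff`, `etale_specOver_quotient_ker_pi_subgroup` at `H = ⊤`). [cite: Tate1997FiniteFlatGroupSchemes, (3.7)]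
[cite: StacksProject, Tag 00U3] -/
theorem exists_isEtaleOf_of_natCard_eq (xbar : AlgPoints (𝓜.localise w).reductionAt (geomResidueField w))
    (hq : Nat.card (𝟙_ (SchemeOver (geomResidueField w)) ⟶ (𝔡 xbar).G₀) = I.pChar ^ I.fDeg) : ∃ H : SubOf I 𝔡 xbar, IsEtaleOf I 𝔡 H := by
  letI := (𝔡 xbar).grp₀
  haveI := (𝔡 xbar).aff₀
  have hpts : Nat.card (specOver (geomResidueField w) (geomResidueField w) ⟶ (𝔡 xbar).G₀) = I.pChar ^ I.fDeg := by
    rw [Nat.card_congr (ptEquiv (𝔡 xbar).G₀ (geomResidueField w)), ← natCard_sections_eq_natCard_algHom]; exact hq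
  haveI : Finite (specOver (geomResidueField w) (geomResidueField w) ⟶ (𝔡 xbar).G₀) :=
    Nat.finite_of_card_ne_zero (by rw [hpts]; exact pow_ne_zero _ I.hpChar.1.ne_zero)
  haveI : Finite ↥(⊤ : Subgroup (specOver (geomResidueField w) (geomResidueField w) ⟶ (𝔡 xbar).G₀)) := Subtype.finite
  have htop : Nat.card ↥(⊤ : Subgroup (specOver (geomResidueField w) (geomResidueField w) ⟶ (𝔡 xbar).G₀)) = I.pChar ^ I.fDeg := by
    rw [Subgroup.card_top]; exact hpts
  refine ⟨⟨RingHom.ker (AlgHom.pi fun x : ↥(⊤ : Subgroup (specOver (geomResidueField w) (geomResidueField w) ⟶ (𝔡 xbar).G₀)) =>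
      ptEquiv (𝔡 xbar).G₀ (geomResidueField w) x.1 : Alg (𝔡 xbar).G₀ →ₐ[geomResidueField w] (↥(⊤ : Subgroup (specOver (geomResidueField w) (geomResidueField w) ⟶ (𝔡 xbar).G₀)) → geomResidueField w)).toRingHom,
    Literature.AlgebraicGeometry.GroupSchemes.EtaleIdealPoints.isHopfIdeal_ker_pi_subgroup _ _,
    (Literature.AlgebraicGeometry.GroupSchemes.EtaleIdealPoints.finrank_quotient_ker_pi_subgroup _ _).trans htop,
    fun a => (Literature.AlgebraicGeometry.GroupSchemes.EtaleIdealPoints.map_appTop_ker_pi_subgroup_le_iff _ _ _).mpr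
      fun x _ => Subgroup.mem_top _⟩,
    Literature.AlgebraicGeometry.GroupSchemes.EtaleIdealPoints.etale_specOver_quotient_ker_pi_subgroup _ _⟩

include 𝔡 in
/-- **two distinct admissible ideals upstairs** (`#LineOf I y = q + 1 ≥ 3` through `eL`): the `htwo` input of ★ SP-SURJ. [cite: Tate1997FiniteFlatGroupSchemes, (3.7)] -/
theorem exists_admK_ne (y : AlgPoints (S.M.obj Kc) (AlgebraicClosure (w.adicCompletion F))) (L₀ : Ideal (Alg (layerΩ I y))) :
    AdmKOf I y L₀ → ∃ L : Ideal (Alg (layerΩ I y)), AdmKOf I y L ∧ L ≠ L₀ := by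
  intro h₀
  have hcard : Nat.card {J : Ideal (Alg (layerΩ I y)) // AdmKOf I y J} = I.pChar ^ I.fDeg + 1 := by
    rw [← Nat.card_congr (eLOf I y)]; exact natCard_lineOf_eq_succ I 𝔡 y
  haveI : Finite {J : Ideal (Alg (layerΩ I y)) // AdmKOf I y J} := Nat.finite_of_card_ne_zero (by rw [hcard]; exact Nat.succ_ne_zero _)
  haveI : Nontrivial {J : Ideal (Alg (layerΩ I y)) // AdmKOf I y J} := by
    rw [← Finite.one_lt_card_iff_nontrivial, hcard]
    have := two_le_pChar_pow_fDeg I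
    omega
  obtain ⟨x, hx⟩ := exists_ne (⟨L₀, h₀⟩ : {J : Ideal (Alg (layerΩ I y)) // AdmKOf I y J})
  exact ⟨x.1, x.2, fun hx' => hx (Subtype.ext hx')⟩

set_option maxHeartbeats 400000 in
open scoped MonObj CategoryTheory.Obj in
/-- **`canonicalLine_spGeoOf`** — (b4′) for `sp := spGeoOf I 𝔡`: the L2 leaf's `CanonicalLineLaw I 𝔡 (spGeoOf I 𝔡)` ∕ L3's `hcan₂`, UNFOLDED VERBATIM (`exists_admK_spI_eq_kerFI` read
through `eLOf` and `spGeoOf_eq_kerFOf_iff`). [cite: Liu2021, p. 137] [cite: Carayol1986Compositio, §10.3 Prop. p. 211] [cite: SerreTate1968, §1 Lemma 1] -/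
theorem canonicalLine_spGeoOf :
    ∀ y, (∃ H : SubOf I 𝔡 (red₀Of S Kc 𝓜 w h𝓨 e y), IsEtaleOf I 𝔡 H) →
      ∃ L₀ : LineOf I y, spGeoOf I 𝔡 y L₀ = kerFOf I 𝔡 (red₀Of S Kc 𝓜 w h𝓨 e y) ∧
        ∀ L : LineOf I y, spGeoOf I 𝔡 y L = kerFOf I 𝔡 (red₀Of S Kc 𝓜 w h𝓨 e y) → L = L₀ := by
  intro y hy
  letI := (toGeomκ w).toAlgebra
  haveI := isMonHom_transR I y
  haveI := isAffine_layerR_left I y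
  haveI := isAffine_layerκ_left I y
  haveI := isAffine_layerΩ_left I y
  obtain ⟨L₀, hA, hsp, hU⟩ := exists_admK_spI_eq_kerFI I 𝔡 y hy
  refine ⟨(eLOf I y).symm ⟨L₀, hA⟩, ?_, fun L hL => ?_⟩
  · rw [spGeoOf_eq_kerFOf_iff]
    show spI _ _ (layerR I y) ((eLOf I y) ((eLOf I y).symm ⟨L₀, hA⟩)).1 = _
    rw [Equiv.apply_symm_apply]
    exact hsp
  · rw [spGeoOf_eq_kerFOf_iff] at hL
    have h1 : ((eLOf I y) L).1 = L₀ := hU _ ((eLOf I y) L).2 hL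
    apply (eLOf I y).injective
    rw [Equiv.apply_symm_apply]
    exact Subtype.ext h1

omit [ExpChar (geomResidueField w) I.pChar] in
set_option maxHeartbeats 400000 in
open scoped MonObj CategoryTheory.Obj in
/-- `spIOf` at the line `eL⁻¹ ⟨L, hL⟩` is `spI L`. [cite: EGAIV2, Prop. 2.8.5] -/
theorem spIOf_eLOf_symm (y : AlgPoints (S.M.obj Kc) (AlgebraicClosure (w.adicCompletion F))) (L : Ideal (Alg (layerΩ I y))) (hL : AdmKOf I y L) :
    letI := (toGeomκ w).toAlgebra
    haveI := isMonHom_transR I y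
    haveI := isAffine_layerR_left I y
    haveI := isAffine_layerκ_left I y
    haveI := isAffine_layerΩ_left I y
    spIOf I y ((eLOf I y).symm ⟨L, hL⟩) = spI (AlgebraicClosure (w.adicCompletion F)) (geomResidueField w) (layerR I y) L := by
  letI := (toGeomκ w).toAlgebra
  haveI := isMonHom_transR I y
  haveI := isAffine_layerR_left I y
  haveI := isAffine_layerκ_left I y
  haveI := isAffine_layerΩ_left I y
  have h2 : (eLOf I y) ((eLOf I y).symm ⟨L, hL⟩) = ⟨L, hL⟩ := Equiv.apply_symm_apply _ _
  show spI _ _ (layerR I y) ((eLOf I y) ((eLOf I y).symm ⟨L, hL⟩)).1 = _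
  rw [h2]

set_option maxHeartbeats 400000 in
open scoped MonObj CategoryTheory.Obj in
/-- **a line whose `spIOf` is `Γ(ε⁻¹)⁻¹ H` specialises to `H`** (back along `εOf`: ★ `comap_appTop_hom_comap_appTop_inv`). [cite: EGAIV2, Prop. 2.8.5]
[cite: Tate1997FiniteFlatGroupSchemes, (3.7)] -/
theorem spGeoOf_eq_of_spIOf_eq (y : AlgPoints (S.M.obj Kc) (AlgebraicClosure (w.adicCompletion F))) (H : SubOf I 𝔡 (red₀Of S Kc 𝓜 w h𝓨 e y)) (ℓ : LineOf I y)
    (hsp : haveI := isMonHom_transR I y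
      spIOf I y ℓ = (H.1.comap (εOf I 𝔡 y).inv.left.appTop.hom : Ideal (Alg (layerκ I y)))) :
    spGeoOf I 𝔡 y ℓ = H :=
  letI := (𝔡 (red₀Of S Kc 𝓜 w h𝓨 e y)).grp₀
  haveI := (𝔡 (red₀Of S Kc 𝓜 w h𝓨 e y)).aff₀
  haveI := isMonHom_transR I y
  Subtype.ext ((spGeoOf_val I 𝔡 y ℓ).trans ((congrArg (fun J : Ideal (Alg (layerκ I y)) =>
    (J.comap (εOf I 𝔡 y).hom.left.appTop.hom : Ideal (Alg (𝔡 (red₀Of S Kc 𝓜 w h𝓨 e y)).G₀))) hsp).trans (comap_appTop_hom_comap_appTop_inv (εOf I 𝔡 y) H.1)))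

set_option maxHeartbeats 400000 in
open scoped MonObj CategoryTheory.Obj in
/-- **SP-SURJ, SUPERSINGULAR DOCK** (`#G₀(κ̄) = 1 < q`): ★ `exists_admissible_spI_eq_of_supersingular` on `layerR I y` (`hone` from `#LineOf I y = q + 1`, `hdich` =
`eq_kerFI_or_etale_layerκ`). [cite: Liu2021, p. 136] [cite: Tate1997FiniteFlatGroupSchemes, (3.7)] -/
theorem spGeoOf_surjective_of_card_eq_one (y : AlgPoints (S.M.obj Kc) (AlgebraicClosure (w.adicCompletion F))) (h1 : Nat.card (𝟙_ (SchemeOver (geomResidueField w)) ⟶ (𝔡 (red₀Of S Kc 𝓜 w h𝓨 e y)).G₀) = 1)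
    (H : SubOf I 𝔡 (red₀Of S Kc 𝓜 w h𝓨 e y)) : ∃ L : LineOf I y, spGeoOf I 𝔡 y L = H := by
  letI := (toGeomκ w).toAlgebra
  haveI := isMonHom_transR I y
  haveI := isAffine_layerR_left I y
  haveI := isAffine_layerκ_left I y
  haveI := isAffine_layerΩ_left I y
  haveI := moduleFinite_alg_layerR I y
  haveI := isFinite_layerκ_hom I y
  have hlt : Nat.card (𝟙_ (SchemeOver (geomResidueField w)) ⟶ layerκ I y) < I.pChar ^ I.fDeg := by
    rw [natCard_sections_layerκ_eq I 𝔡 y, h1]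
    have := two_le_pChar_pow_fDeg I
    omega
  have hne : Nonempty (LineOf I y) := by
    have hc := natCard_lineOf_eq_succ I 𝔡 y
    exact (Nat.card_pos_iff.mp (by rw [hc]; exact Nat.succ_pos _)).1
  obtain ⟨Lany⟩ := hne
  obtain ⟨L, hL, hsp⟩ := Literature.AlgebraicGeometry.GroupSchemes.AdmSpecialFibreSurj.exists_admissible_spI_eq_of_supersingular
    (AlgebraicClosure (w.adicCompletion F)) (geomResidueField w) (layerR I y) (βR I y) (I.pChar ^ I.fDeg) hlt (kerFI I.pChar I.fDeg (layerκ I y)) ⟨(eLOf I y Lany).1, (eLOf I y Lany).2⟩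
    (eq_kerFI_or_etale_layerκ I 𝔡 y) _ (isAdm_comap_εOf_inv I 𝔡 y H)
  exact ⟨(eLOf I y).symm ⟨L, hL⟩, spGeoOf_eq_of_spIOf_eq I 𝔡 y H _ ((spIOf_eLOf_symm I y L hL).trans hsp)⟩

set_option maxHeartbeats 400000 in
open scoped MonObj CategoryTheory.Obj in
/-- **SP-SURJ, ORDINARY DOCK** (`#G₀(κ̄) = q`): ★ `exists_admissible_spI_eq_of_ordinary` on `layerR I y` with the canonical line (`exists_admK_spI_eq_kerFI`, `hord` by
`exists_isEtaleOf_of_natCard_eq`), `htwo` = `exists_admK_ne`, `hdich` = `eq_kerFI_or_etale_layerκ`. [cite: Liu2021, p. 136] [cite: Tate1997FiniteFlatGroupSchemes, (3.7)] -/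
theorem spGeoOf_surjective_of_card_eq (y : AlgPoints (S.M.obj Kc) (AlgebraicClosure (w.adicCompletion F))) (hq : Nat.card (𝟙_ (SchemeOver (geomResidueField w)) ⟶ (𝔡 (red₀Of S Kc 𝓜 w h𝓨 e y)).G₀) = I.pChar ^ I.fDeg)
    (H : SubOf I 𝔡 (red₀Of S Kc 𝓜 w h𝓨 e y)) : ∃ L : LineOf I y, spGeoOf I 𝔡 y L = H := by
  letI := (toGeomκ w).toAlgebra
  haveI := isMonHom_transR I y
  haveI := isAffine_layerR_left I y
  haveI := isAffine_layerκ_left I y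
  haveI := isAffine_layerΩ_left I y
  haveI := moduleFinite_alg_layerR I y
  haveI := isFinite_layerκ_hom I y
  have hq' : Nat.card (𝟙_ (SchemeOver (geomResidueField w)) ⟶ layerκ I y) = I.pChar ^ I.fDeg := by rw [natCard_sections_layerκ_eq I 𝔡 y, hq]
  obtain ⟨L₀, hA, hsp0, hU⟩ := exists_admK_spI_eq_kerFI I 𝔡 y (exists_isEtaleOf_of_natCard_eq I 𝔡 _ hq)
  obtain ⟨L, hL, hsp⟩ := Literature.AlgebraicGeometry.GroupSchemes.AdmSpecialFibreSurj.exists_admissible_spI_eq_of_ordinary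
    (AlgebraicClosure (w.adicCompletion F)) (geomResidueField w) (layerR I y) (βR I y) (I.pChar ^ I.fDeg) hq' (kerFI I.pChar I.fDeg (layerκ I y)) ⟨L₀, hA, hsp0⟩
    (fun L L' hL hL' h h' => (hU L hL h).trans (hU L' hL' h').symm) (exists_admK_ne I 𝔡 y) (eq_kerFI_or_etale_layerκ I 𝔡 y) _
    (isAdm_comap_εOf_inv I 𝔡 y H)
  exact ⟨(eLOf I y).symm ⟨L, hL⟩, spGeoOf_eq_of_spIOf_eq I 𝔡 y H _ ((spIOf_eLOf_symm I y L hL).trans hsp)⟩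

/-- **`spGeoOf_surjective`** — SP-surjectivity for `sp := spGeoOf I 𝔡` (= the L2 leaf's `SpSurjLaw I 𝔡 (spGeoOf I 𝔡)`, UNFOLDED VERBATIM): cases on the dock row `hpts₀`.
[cite: Liu2021, p. 137] [cite: Tate1997FiniteFlatGroupSchemes, (3.7)] [cite: EGAIV2, Prop. 2.8.5] -/
theorem spGeoOf_surjective :
    ∀ y (H : SubOf I 𝔡 (red₀Of S Kc 𝓜 w h𝓨 e y)), ∃ L : LineOf I y, spGeoOf I 𝔡 y L = H := by
  intro y H
  rcases (𝔡 (red₀Of S Kc 𝓜 w h𝓨 e y)).hpts₀ with h1 | hq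
  · exact spGeoOf_surjective_of_card_eq_one I 𝔡 y h1 H
  · exact spGeoOf_surjective_of_card_eq I 𝔡 y hq H

end Laws

/-! ### § LevelCoprime — `p ∤ N` AT EVERY SPECIAL POINT (ED. 3; LA2-p04 (g2) `LevelCoprime.leaflet.v1` 14f7ae5b by copy; LEAD «M-75» (O2′), LA2-plan (g2) RULINGS #3 (1)) -/

section LevelCoprime

-- the frame of the D-line՚s `Letters` section VERBATIM
variable {F : Type} [Field F] [NumberField F] [IsCMField F] {ι₁ : F →+* ℂ}
    {Jstar : Matrix (Fin 2) (Fin 2) F}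
    {K₀ : C5.OpenCompactSubgroup ↥(finAdelic ↥(maximalRealSubfield F) F (IsCMField.complexConj F) 2 Jstar)}
    {S : RecordSystemGS F Jstar ι₁ K₀} {hU7ₛ : S.HeckeTranslateDefinedOver}
    {hJ : (Jstar.map (IsCMField.complexConj F))ᵀ = Jstar} {hJu : IsUnit Jstar}
    {Fi : Type} [Field Fi] [Algebra F Fi] {Kc : C5.SmallLevel K₀} {G : Type} [Group G]
    {𝓜 : IntegralModel (𝓞 F) F ((thickening F Fi).obj (S.M.obj Kc))}
    {w : HeightOneSpectrum (𝓞 F)} {hw : (IsCMField.complexConj F) • w ≠ w} {h𝓨 : (𝓜.localise w).IsSmoothProper 1}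
    {θ : ActionOver (𝓜.localise w).total.hom ((Fi ≃ₐ[F] Fi) × G)}
    {e : Fi →ₐ[F] AlgebraicClosure (w.adicCompletion F)}

/-- **`coprime_pChar_N_of_specialPoint` — THE LEVEL IS PRIME TO THE RESIDUE CHARACTERISTIC** («`p ∤ N` junction», LEAD «M-75» (O2′)): for the datum `I` and ANY special
point `x̄ ∈ 𝓨_s(κ̄(w))`, if `0 < I.g` then `Nat.Coprime I.pChar I.N` — the interim binder `hpN` of the L2 heads DISCHARGED.  ONE TERM: ★ `LevelStructure.coprime_of_charP` at
the level structure `I.lvl` (`univ.LevelStructure g N`), the geometric point `spPt 𝓜 w x̄ : Spec κ̄(w) → 𝓨` of the base, `I.relDim` (`univ.IsOfRelDim g`), and the characteristic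
`I.charP₀` (`CharP κ̄(w) pChar`, `I.hpChar.1` prime); NO `I.N ≠ 0` hypothesis (the `N = 0` branch is refuted inside ★ by the `ℓ`-torsion count at a prime `ℓ ≠ pChar`, the
`p ∣ N` branch by ★ (P-TOR): fewer than `p^{2g}` `p`-torsion points in characteristic `p`).
[cite: MumfordFogartyKirwan1994, Ch. 7 §2 Definition 7.1 (p. 129), §3 Theorem 7.9 (p. 139)] [cite: MumfordAV1970, §15 (p. 147), §6 Application 3 (p. 64)] -/
theorem coprime_pChar_N_of_specialPoint (I : RGDInputsAt F ι₁ Jstar K₀ S hU7ₛ hJ hJu Fi Kc G 𝓜 w hw h𝓨 θ e)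
    (xbar : AlgPoints (𝓜.localise w).reductionAt (geomResidueField w)) (hg : 0 < I.g) : Nat.Coprime I.pChar I.N :=
  haveI : Fact I.pChar.Prime := ⟨I.hpChar.1⟩
  haveI : CharP (geomResidueField w) I.pChar := I.charP₀
  I.lvl.coprime_of_charP (spPt 𝓜 w xbar) I.relDim hg I.pChar

end LevelCoprime

end Summit.HodgeConjecture.HodgeConjecture.Cruxes.HLiu418.F0P6aLineSpecialisation

end
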